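import Mathlib
import Summits.Ventures.PercRepro2.PendantA3Bern

/-!
# The pendant `a₃` at an UNMARKED vertex: (HCOV) at the pins plus the auxiliary inequality (Gaux)
(blind cell PercRepro2, night-1 g37)

`PendantA3Bern.HCov_pendant_of_cov_nonneg` (p5 g15) closes (HCOV) at a pendant edge `f = {a₃, u}` from
(HCOV) at the two pins `p[f↦0]`, `p[f↦1]` and the union-cluster covariance `Cov_ν(U_o, U_u) ≥ 0` —
a hypothesis that is FALSE in general (NEG-121: union-membership is not positively associated under
`Q`).  The identities `B1Poly_pendant` / `B2Poly_pendant` only use that hypothesis through the single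
product `Q·(Qo·D_u − Q·Do_u)·Ŝ_u` (the union-cluster covariance of `(o, u)` times the `(b, u)` BHK
slack), and the `D_u²·Gc⁰` term of the same identity is available to absorb a negative value of it.
This file names the exact combination:

* **`gauxC`** `= D_u² · Gc⁰ + Q · (Qo·D_u − Q·Do_u) · Ŝ_u` with `Gc⁰ = 2Q·[S(bL,oH) + S(bH,oL)]` the value
  of `Gc` with `a₃` isolated (`gcZero_eq`: `GcPoly` at the pin-zero masses), `Qo·D_u − Q·Do_u
  = Q²·Cov_ν(U_o, U_u)`, `Ŝ_u = 2[S(bL,uH) + S(bH,uL)]` — in the conditional law `μ = P(· | Q)`: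
  `gauxC = 2Q⁵ · [μ(u ∉ U)²·(S(bL,oH) + S(bH,oL)) + Cov_μ(U_o, U_u)·(S(bL,uH) + S(bH,uL))]`;
  **`Gaux := 0 ≤ gauxC`** is a statement about the four marks `o, a₁, a₂, b` and the vertex `u` only
  (no `a₃`, no `PD`-world of `a₃`);
* **`gauxC_nonneg_of_cov_nonneg`**: `Cov_ν(U_o, U_u) ≥ 0 ⟹ Gaux` (so the hypothesis below is strictly
  weaker than p5's).  `Gaux` is NOT a theorem either: the kit adversary (night-1 g37, own code, kit
  j336895 / j336896, exact re-check) refutes it with 11 + 3 exact negatives at `n = 5–8` — e.g. `n = 6`,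
  edges `01 45 34 15 13 24 23 04 14 03`, `(o, a₁, a₂, u, b) = (2, 5, 3, 1, 0)`, weights
  `(970447, 993330, 996541, 919788, 53031, 515451, 675860, 36743, 818540, 9728)/10⁶`: `P(Q) = 0.00365`,
  `μ(u ∉ U) = 0.0323`, `Cov_μ(U_o, U_u) = −8.0·10⁻⁴`, `Gaux = −1.14·10⁻⁴` in the units of `μ` — while
  the FULL middle Bernstein coefficient (`Gaux + μ(u ∉ U)·G_u` up to normalisation, `G_u` the crux
  value of the fused instance) survives the same climbs (0 exact negatives in 6,656): at a pendant
  unmarked `a₃` the failure of (U-PA) is covered by the fused crux value, not by a crux-free inequality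
  of this shape;
* **`B1_nonneg_pendant_of_gaux`**, **`B2_nonneg_pendant_of_gaux`**, **`HCov_pendant_of_gaux`**:
  at a pendant edge of `a₃` with `P(PD_u) > 0`, (HCOV) at both pins and `Gaux` give (HCOV) at `p`.
  Reading: the pendant `a₃` at an UNMARKED vertex — the last open pendant of the residual calculus —
  is a reducible configuration of (HCOV) modulo `Gaux`, a lower-complexity inequality without the crux;
  since `Gaux` fails on some instances, the reduction is conditional there and the Bernstein route
  needs the crux value of the fused instance (p2's (PM⁺)) on exactly those instances.
-/

namespace Summit.Ventures.PercRepro2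

open UnionCluster CovForm PendantRoot

namespace PendantA3

section Defs

variable {V : Type*} {E : Type*} [Fintype E] [DecidableEq E] [DecidableEq V] {R : Type*}
  [Field R] [LinearOrder R]

/-- **`Gc⁰`**: the value of `Gc` when `a₃` is isolated, `2Q·[S(bL,oH) + S(bH,oL)]` with the cleared
BHK cross slacks `S(bL,oH) = P(Q,bL)P(Q,oH) − P(Q)P(Q,bL,oH)`, `S(bH,oL) = P(Q,bH)P(Q,oL) − P(Q)P(Q,bH,oL)`. -/
noncomputable def gcZero (p : E → R) (ends : E → Sym2 V) (o a₁ a₂ b : V) : R :=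
  2 * prob p (avoidAll ends a₂ {a₁}) *
    ((prob p (avoidAll ends a₂ {a₁} ∩ connEvent ends a₁ b) *
        prob p (avoidAll ends a₂ {a₁} ∩ connEvent ends a₂ o) -
      prob p (avoidAll ends a₂ {a₁}) *
        prob p (avoidAll ends a₂ {a₁} ∩ (connEvent ends a₂ o ∩ connEvent ends a₁ b))) +
     (prob p (avoidAll ends a₂ {a₁} ∩ connEvent ends a₂ b) *
        prob p (avoidAll ends a₂ {a₁} ∩ connEvent ends a₁ o) -
      prob p (avoidAll ends a₂ {a₁}) *
        prob p (avoidAll ends a₂ {a₁} ∩ (connEvent ends a₁ o ∩ connEvent ends a₂ b))))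

/-- **The slack factor** `Ŝ_u = Q·EQb3_u + gap·EQ3_u + Q·PDb_u − D_u·Qb` of `PendantA3Pins.slack_nonneg`
(`= 2[S(bL,uH) + S(bH,uL)]`). -/
noncomputable def slackU (p : E → R) (ends : E → Sym2 V) (a₁ a₂ u b : V) : R :=
  prob p (avoidAll ends a₂ {a₁}) * EQb3 p ends a₁ a₂ u b +
    gap p ends a₁ a₂ b * EQ3 p ends a₁ a₂ u +
    prob p (avoidAll ends a₂ {a₁}) * PDb p ends a₁ a₂ u b -
    prob p (PDEvent ends a₁ a₂ u) *
      (prob p (avoidAll ends a₂ {a₁} ∩ connEvent ends a₁ b) +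
        prob p (avoidAll ends a₂ {a₁} ∩ connEvent ends a₂ b))

/-- **`gauxC`** `= D_u² · Gc⁰ + Q · (Qo·D_u − Q·Do_u) · Ŝ_u`. -/
noncomputable def gauxC (p : E → R) (ends : E → Sym2 V) (o a₁ a₂ u b : V) : R :=
  prob p (PDEvent ends a₁ a₂ u) * prob p (PDEvent ends a₁ a₂ u) * gcZero p ends o a₁ a₂ b +
    prob p (avoidAll ends a₂ {a₁}) *
      ((prob p (avoidAll ends a₂ {a₁} ∩ connEvent ends a₁ o) +
          prob p (avoidAll ends a₂ {a₁} ∩ connEvent ends a₂ o)) * prob p (PDEvent ends a₁ a₂ u) -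
        prob p (avoidAll ends a₂ {a₁}) * Do p ends o a₁ a₂ u) *
      slackU p ends a₁ a₂ u b

/-- **(Gaux)**: `0 ≤ gauxC`. -/
def Gaux (p : E → R) (ends : E → Sym2 V) (o a₁ a₂ u b : V) : Prop :=
  0 ≤ gauxC p ends o a₁ a₂ u b

end Defs

section Identities

variable {V : Type*} {E : Type*} [Fintype E] [DecidableEq E] [DecidableEq V] {R : Type*}
  [Field R] [LinearOrder R] [IsStrictOrderedRing R]

omit [DecidableEq V] in
/-- `GcPoly` at the pin-zero masses of a pendant `a₃` (`a₃` isolated: `PD = Q`, every `σ₃`-mass `0`)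
is `Gc⁰ = 2Q·[S(bL,oH) + S(bH,oL)]`. -/
lemma gcPoly_zero_eq (p : E → R) (ends : E → Sym2 V) (o a₁ a₂ b : V) :
    EdgeLine.GcPoly (prob p (avoidAll ends a₂ {a₁})) (prob p (avoidAll ends a₂ {a₁}))
        (prob p (avoidAll ends a₂ {a₁} ∩ connEvent ends a₁ o) +
          prob p (avoidAll ends a₂ {a₁} ∩ connEvent ends a₂ o))
        (EQbo p ends o a₁ a₂ b) 0 0 (EQo p ends o a₁ a₂) 0 0
        (prob p (avoidAll ends a₂ {a₁} ∩ connEvent ends a₁ b) +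
          prob p (avoidAll ends a₂ {a₁} ∩ connEvent ends a₂ b))
        (prob p (avoidAll ends a₂ {a₁} ∩ (connEvent ends a₁ o ∩ connEvent ends a₁ b)) +
          prob p (avoidAll ends a₂ {a₁} ∩ (connEvent ends a₂ o ∩ connEvent ends a₁ b)) +
          prob p (avoidAll ends a₂ {a₁} ∩ (connEvent ends a₁ o ∩ connEvent ends a₂ b)) +
          prob p (avoidAll ends a₂ {a₁} ∩ (connEvent ends a₂ o ∩ connEvent ends a₂ b)))
        (gap p ends a₁ a₂ b) = gcZero p ends o a₁ a₂ b := by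
  unfold EdgeLine.GcPoly gcZero EQbo EQo
  rw [gap_eq_Q]
  ring

/-- `0 ≤ Gc⁰` (BHK06 Thm 1.4 twice, `A3Inactive.bLoH_mul_Q_le` / `bHoL_mul_Q_le`). -/
lemma gcZero_nonneg [Fintype V] (p : E → R) (hp : IsProbVec p) (ends : E → Sym2 V)
    (o a₁ a₂ b : V) : 0 ≤ gcZero p ends o a₁ a₂ b := by
  unfold gcZero
  have h1 := A3Inactive.bLoH_mul_Q_le p hp ends o a₁ a₂ b
  have h2 := A3Inactive.bHoL_mul_Q_le p hp ends o a₁ a₂ b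
  have hQ := prob_nonneg hp (avoidAll ends a₂ {a₁})
  have : 0 ≤ (prob p (avoidAll ends a₂ {a₁} ∩ connEvent ends a₁ b) *
        prob p (avoidAll ends a₂ {a₁} ∩ connEvent ends a₂ o) -
      prob p (avoidAll ends a₂ {a₁}) *
        prob p (avoidAll ends a₂ {a₁} ∩ (connEvent ends a₂ o ∩ connEvent ends a₁ b))) +
     (prob p (avoidAll ends a₂ {a₁} ∩ connEvent ends a₂ b) *
        prob p (avoidAll ends a₂ {a₁} ∩ connEvent ends a₁ o) -
      prob p (avoidAll ends a₂ {a₁}) *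
        prob p (avoidAll ends a₂ {a₁} ∩ (connEvent ends a₁ o ∩ connEvent ends a₂ b))) := by
    linarith
  have h2Q : 0 ≤ 2 * prob p (avoidAll ends a₂ {a₁}) := by linarith
  exact mul_nonneg h2Q this

/-- `0 ≤ Ŝ_u` (`PendantA3Pins.slack_nonneg`). -/
lemma slackU_nonneg [Fintype V] (p : E → R) (hp : IsProbVec p) (ends : E → Sym2 V)
    (a₁ a₂ u b : V) : 0 ≤ slackU p ends a₁ a₂ u b :=
  slack_nonneg p hp ends a₁ a₂ u b

/-- **`Cov_ν(U_o, U_u) ≥ 0 ⟹ Gaux`**: p5's hypothesis (in its cleared form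
`P(Q)·P(PD_u, o ∈ U) ≤ P(Q, o ∈ U)·P(PD_u)`) implies `Gaux`. -/
theorem gauxC_nonneg_of_cov_nonneg [Fintype V] (p : E → R) (hp : IsProbVec p) (ends : E → Sym2 V)
    (o a₁ a₂ u b : V)
    (hcov : prob p (avoidAll ends a₂ {a₁}) * Do p ends o a₁ a₂ u ≤
      (prob p (avoidAll ends a₂ {a₁} ∩ connEvent ends a₁ o) +
        prob p (avoidAll ends a₂ {a₁} ∩ connEvent ends a₂ o)) * prob p (PDEvent ends a₁ a₂ u)) :
    Gaux p ends o a₁ a₂ u b := by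
  unfold Gaux gauxC
  have hD := prob_nonneg hp (PDEvent ends a₁ a₂ u)
  have hQ := prob_nonneg hp (avoidAll ends a₂ {a₁})
  have h0 := gcZero_nonneg p hp ends o a₁ a₂ b
  have hs := slackU_nonneg p hp ends a₁ a₂ u b
  have hc : 0 ≤ (prob p (avoidAll ends a₂ {a₁} ∩ connEvent ends a₁ o) +
      prob p (avoidAll ends a₂ {a₁} ∩ connEvent ends a₂ o)) * prob p (PDEvent ends a₁ a₂ u) -
      prob p (avoidAll ends a₂ {a₁}) * Do p ends o a₁ a₂ u := by linarith
  exact add_nonneg (mul_nonneg (mul_nonneg hD hD) h0) (mul_nonneg (mul_nonneg hQ hc) hs)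

end Identities

section Main

variable {V : Type*} {E : Type*} [Fintype V] [DecidableEq V] [Fintype E] [DecidableEq E]
  {R : Type*} [Field R] [LinearOrder R] [IsStrictOrderedRing R]

open EdgeLine

omit [Fintype V] in
/-- **`0 ≤ B1` at a pendant edge of `a₃`** with attachment vertex `u`, given (HCOV) at both pins,
`P(PD_u) > 0` and `Gaux`. -/
theorem B1_nonneg_pendant_of_gaux (p : E → R) (hp : IsProbVec p) {ends : E → Sym2 V} {f : E}
    {o a₁ a₂ a₃ b u : V} (hf : ends f = s(a₃, u)) (hleaf : ∀ e, a₃ ∈ ends e → e = f)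
    (h3u : a₃ ≠ u) (h13 : a₁ ≠ a₃) (h23 : a₂ ≠ a₃) (ho3 : o ≠ a₃) (hb3 : b ≠ a₃)
    (hD : 0 < prob p (PDEvent ends a₁ a₂ u))
    (h₀ : HCov (Function.update p f 0) ends o a₁ a₂ a₃ b)
    (h₁ : HCov (Function.update p f 1) ends o a₁ a₂ a₃ b)
    (hg : Gaux p ends o a₁ a₂ u b) :
    0 ≤ B1 p ends o a₁ a₂ a₃ b f := by
  obtain ⟨hQ0, hD0, hDo0, hEQbo0, hEQb3_0, hEQb3o0, hEQo0, hEQ3_0, hEQ3o0, hPDb0, hPDbo0, hgap0⟩ :=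
    pins_zero_pendant p hf hleaf h3u h13 h23 ho3 hb3
  obtain ⟨hQ1, hD1, hDo1, hEQbo1, hEQb3_1, hEQb3o1, hEQo1, hEQ3_1, hEQ3o1, hPDb1, hPDbo1, hgap1⟩ :=
    pins_one_pendant p hf hleaf h3u h13 h23 ho3 hb3
  unfold HCov at h₀ h₁
  rw [Gc_eq_GcPoly] at h₀ h₁
  unfold B1
  rw [hQ0, hD0, hDo0, hEQbo0, hEQb3_0, hEQb3o0, hEQo0, hEQ3_0, hEQ3o0, hPDb0, hPDbo0, hgap0] at h₀
  rw [hQ1, hD1, hDo1, hEQbo1, hEQb3_1, hEQb3o1, hEQo1, hEQ3_1, hEQ3o1, hPDb1, hPDbo1, hgap1] at h₁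
  rw [hQ0, hD0, hDo0, hEQbo0, hEQb3_0, hEQb3o0, hEQo0, hEQ3_0, hEQ3o0, hPDb0, hPDbo0, hgap0, hQ1,
    hD1, hDo1, hEQbo1, hEQb3_1, hEQb3o1, hEQo1, hEQ3_1, hEQ3o1, hPDb1, hPDbo1, hgap1]
  have hQ : 0 ≤ prob p (avoidAll ends a₂ {a₁}) := prob_nonneg hp _
  have hQD : 0 < prob p (avoidAll ends a₂ {a₁}) * prob p (PDEvent ends a₁ a₂ u) := by
    have hle : prob p (PDEvent ends a₁ a₂ u) ≤ prob p (avoidAll ends a₂ {a₁}) := by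
      have := prob_PD_u_inter p ends a₁ a₂ u Set.univ
      simp only [Set.inter_univ] at this
      rw [this]
      linarith [prob_nonneg hp (avoidAll ends a₂ {a₁} ∩ connEvent ends a₂ u),
        prob_nonneg hp (avoidAll ends a₂ {a₁} ∩ connEvent ends a₁ u)]
    exact mul_pos (lt_of_lt_of_le hD hle) hD
  have key := B1Poly_pendant (prob p (avoidAll ends a₂ {a₁})) (gap p ends a₁ a₂ b)
    (EQbo p ends o a₁ a₂ b) (EQo p ends o a₁ a₂)
    (prob p (avoidAll ends a₂ {a₁} ∩ connEvent ends a₁ o) +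
      prob p (avoidAll ends a₂ {a₁} ∩ connEvent ends a₂ o))
    (prob p (avoidAll ends a₂ {a₁} ∩ connEvent ends a₁ b) +
      prob p (avoidAll ends a₂ {a₁} ∩ connEvent ends a₂ b))
    (prob p (avoidAll ends a₂ {a₁} ∩ (connEvent ends a₁ o ∩ connEvent ends a₁ b)) +
      prob p (avoidAll ends a₂ {a₁} ∩ (connEvent ends a₂ o ∩ connEvent ends a₁ b)) +
      prob p (avoidAll ends a₂ {a₁} ∩ (connEvent ends a₁ o ∩ connEvent ends a₂ b)) +
      prob p (avoidAll ends a₂ {a₁} ∩ (connEvent ends a₂ o ∩ connEvent ends a₂ b)))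
    (prob p (PDEvent ends a₁ a₂ u)) (Do p ends o a₁ a₂ u) (EQb3 p ends a₁ a₂ u b)
    (EQb3o p ends o a₁ a₂ u b) (EQ3 p ends a₁ a₂ u) (EQ3o p ends o a₁ a₂ u)
    (PDb p ends a₁ a₂ u b) (PDbo p ends o a₁ a₂ u b)
  unfold Gaux gauxC slackU at hg
  rw [← gcPoly_zero_eq p ends o a₁ a₂ b] at hg
  have hrhs : 0 ≤ prob p (avoidAll ends a₂ {a₁}) * prob p (PDEvent ends a₁ a₂ u) *
      B1Poly (prob p (avoidAll ends a₂ {a₁})) (prob p (avoidAll ends a₂ {a₁}))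
        (prob p (avoidAll ends a₂ {a₁} ∩ connEvent ends a₁ o) +
          prob p (avoidAll ends a₂ {a₁} ∩ connEvent ends a₂ o))
        (EQbo p ends o a₁ a₂ b) 0 0 (EQo p ends o a₁ a₂) 0 0
        (prob p (avoidAll ends a₂ {a₁} ∩ connEvent ends a₁ b) +
          prob p (avoidAll ends a₂ {a₁} ∩ connEvent ends a₂ b))
        (prob p (avoidAll ends a₂ {a₁} ∩ (connEvent ends a₁ o ∩ connEvent ends a₁ b)) +
          prob p (avoidAll ends a₂ {a₁} ∩ (connEvent ends a₂ o ∩ connEvent ends a₁ b)) +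
          prob p (avoidAll ends a₂ {a₁} ∩ (connEvent ends a₁ o ∩ connEvent ends a₂ b)) +
          prob p (avoidAll ends a₂ {a₁} ∩ (connEvent ends a₂ o ∩ connEvent ends a₂ b)))
        (gap p ends a₁ a₂ b)
        (prob p (avoidAll ends a₂ {a₁})) (prob p (PDEvent ends a₁ a₂ u)) (Do p ends o a₁ a₂ u)
        (EQbo p ends o a₁ a₂ b) (EQb3 p ends a₁ a₂ u b) (EQb3o p ends o a₁ a₂ u b)
        (EQo p ends o a₁ a₂) (EQ3 p ends a₁ a₂ u) (EQ3o p ends o a₁ a₂ u)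
        (PDb p ends a₁ a₂ u b) (PDbo p ends o a₁ a₂ u b) (gap p ends a₁ a₂ b) := by
    rw [key]
    have t1 := mul_nonneg (mul_nonneg hQ hD.le) h₀
    have t3 := mul_nonneg (mul_nonneg hQ hQ) h₁
    linarith
  exact (mul_nonneg_iff_of_pos_left hQD).1 hrhs

omit [Fintype V] in
/-- **`0 ≤ B2` at a pendant edge of `a₃`** given (HCOV) at the pin `p[f↦1]`, `P(PD_u) > 0` and `Gaux`
(the pin `p[f↦0]` enters only through `Gaux`). -/
theorem B2_nonneg_pendant_of_gaux (p : E → R) (hp : IsProbVec p) {ends : E → Sym2 V} {f : E}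
    {o a₁ a₂ a₃ b u : V} (hf : ends f = s(a₃, u)) (hleaf : ∀ e, a₃ ∈ ends e → e = f)
    (h3u : a₃ ≠ u) (h13 : a₁ ≠ a₃) (h23 : a₂ ≠ a₃) (ho3 : o ≠ a₃) (hb3 : b ≠ a₃)
    (hD : 0 < prob p (PDEvent ends a₁ a₂ u))
    (h₁ : HCov (Function.update p f 1) ends o a₁ a₂ a₃ b)
    (hg : Gaux p ends o a₁ a₂ u b) :
    0 ≤ B2 p ends o a₁ a₂ a₃ b f := by
  obtain ⟨hQ0, hD0, hDo0, hEQbo0, hEQb3_0, hEQb3o0, hEQo0, hEQ3_0, hEQ3o0, hPDb0, hPDbo0, hgap0⟩ :=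
    pins_zero_pendant p hf hleaf h3u h13 h23 ho3 hb3
  obtain ⟨hQ1, hD1, hDo1, hEQbo1, hEQb3_1, hEQb3o1, hEQo1, hEQ3_1, hEQ3o1, hPDb1, hPDbo1, hgap1⟩ :=
    pins_one_pendant p hf hleaf h3u h13 h23 ho3 hb3
  unfold HCov at h₁
  rw [Gc_eq_GcPoly] at h₁
  unfold B2
  rw [hQ1, hD1, hDo1, hEQbo1, hEQb3_1, hEQb3o1, hEQo1, hEQ3_1, hEQ3o1, hPDb1, hPDbo1, hgap1] at h₁
  rw [hQ0, hD0, hDo0, hEQbo0, hEQb3_0, hEQb3o0, hEQo0, hEQ3_0, hEQ3o0, hPDb0, hPDbo0, hgap0, hQ1,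
    hD1, hDo1, hEQbo1, hEQb3_1, hEQb3o1, hEQo1, hEQ3_1, hEQ3o1, hPDb1, hPDbo1, hgap1]
  have hQ : 0 ≤ prob p (avoidAll ends a₂ {a₁}) := prob_nonneg hp _
  have hQD : 0 < prob p (avoidAll ends a₂ {a₁}) * prob p (PDEvent ends a₁ a₂ u) := by
    have hle : prob p (PDEvent ends a₁ a₂ u) ≤ prob p (avoidAll ends a₂ {a₁}) := by
      have := prob_PD_u_inter p ends a₁ a₂ u Set.univ
      simp only [Set.inter_univ] at this
      rw [this]
      linarith [prob_nonneg hp (avoidAll ends a₂ {a₁} ∩ connEvent ends a₂ u),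
        prob_nonneg hp (avoidAll ends a₂ {a₁} ∩ connEvent ends a₁ u)]
    exact mul_pos (lt_of_lt_of_le hD hle) hD
  have key := B2Poly_pendant (prob p (avoidAll ends a₂ {a₁})) (gap p ends a₁ a₂ b)
    (EQbo p ends o a₁ a₂ b) (EQo p ends o a₁ a₂)
    (prob p (avoidAll ends a₂ {a₁} ∩ connEvent ends a₁ o) +
      prob p (avoidAll ends a₂ {a₁} ∩ connEvent ends a₂ o))
    (prob p (avoidAll ends a₂ {a₁} ∩ connEvent ends a₁ b) +
      prob p (avoidAll ends a₂ {a₁} ∩ connEvent ends a₂ b))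
    (prob p (avoidAll ends a₂ {a₁} ∩ (connEvent ends a₁ o ∩ connEvent ends a₁ b)) +
      prob p (avoidAll ends a₂ {a₁} ∩ (connEvent ends a₂ o ∩ connEvent ends a₁ b)) +
      prob p (avoidAll ends a₂ {a₁} ∩ (connEvent ends a₁ o ∩ connEvent ends a₂ b)) +
      prob p (avoidAll ends a₂ {a₁} ∩ (connEvent ends a₂ o ∩ connEvent ends a₂ b)))
    (prob p (PDEvent ends a₁ a₂ u)) (Do p ends o a₁ a₂ u) (EQb3 p ends a₁ a₂ u b)
    (EQb3o p ends o a₁ a₂ u b) (EQ3 p ends a₁ a₂ u) (EQ3o p ends o a₁ a₂ u)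
    (PDb p ends a₁ a₂ u b) (PDbo p ends o a₁ a₂ u b)
  unfold Gaux gauxC slackU at hg
  rw [← gcPoly_zero_eq p ends o a₁ a₂ b] at hg
  have hrhs : 0 ≤ prob p (avoidAll ends a₂ {a₁}) * prob p (PDEvent ends a₁ a₂ u) *
      B2Poly (prob p (avoidAll ends a₂ {a₁})) (prob p (avoidAll ends a₂ {a₁}))
        (prob p (avoidAll ends a₂ {a₁} ∩ connEvent ends a₁ o) +
          prob p (avoidAll ends a₂ {a₁} ∩ connEvent ends a₂ o))
        (EQbo p ends o a₁ a₂ b) 0 0 (EQo p ends o a₁ a₂) 0 0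
        (prob p (avoidAll ends a₂ {a₁} ∩ connEvent ends a₁ b) +
          prob p (avoidAll ends a₂ {a₁} ∩ connEvent ends a₂ b))
        (prob p (avoidAll ends a₂ {a₁} ∩ (connEvent ends a₁ o ∩ connEvent ends a₁ b)) +
          prob p (avoidAll ends a₂ {a₁} ∩ (connEvent ends a₂ o ∩ connEvent ends a₁ b)) +
          prob p (avoidAll ends a₂ {a₁} ∩ (connEvent ends a₁ o ∩ connEvent ends a₂ b)) +
          prob p (avoidAll ends a₂ {a₁} ∩ (connEvent ends a₂ o ∩ connEvent ends a₂ b)))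
        (gap p ends a₁ a₂ b)
        (prob p (avoidAll ends a₂ {a₁})) (prob p (PDEvent ends a₁ a₂ u)) (Do p ends o a₁ a₂ u)
        (EQbo p ends o a₁ a₂ b) (EQb3 p ends a₁ a₂ u b) (EQb3o p ends o a₁ a₂ u b)
        (EQo p ends o a₁ a₂) (EQ3 p ends a₁ a₂ u) (EQ3o p ends o a₁ a₂ u)
        (PDb p ends a₁ a₂ u b) (PDbo p ends o a₁ a₂ u b) (gap p ends a₁ a₂ b) := by
    rw [key]
    have t1 := mul_nonneg (mul_nonneg hQ hD.le) h₁
    have t3 := mul_nonneg (mul_nonneg hQ hQ) h₁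
    linarith
  exact (mul_nonneg_iff_of_pos_left hQD).1 hrhs

omit [Fintype V] in
/-- **The pendant closure of (HCOV) modulo `Gaux`**: at a pendant edge `f` of `a₃` with attachment
vertex `u`, (HCOV) at `p[f↦0]` and at `p[f↦1]`, `P(PD_u) > 0` and `Gaux` give (HCOV) at `p`. -/
theorem HCov_pendant_of_gaux (p : E → R) (hp : IsProbVec p) {ends : E → Sym2 V} {f : E}
    {o a₁ a₂ a₃ b u : V} (hf : ends f = s(a₃, u)) (hleaf : ∀ e, a₃ ∈ ends e → e = f)
    (h3u : a₃ ≠ u) (h13 : a₁ ≠ a₃) (h23 : a₂ ≠ a₃) (ho3 : o ≠ a₃) (hb3 : b ≠ a₃)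
    (hD : 0 < prob p (PDEvent ends a₁ a₂ u))
    (h₀ : HCov (Function.update p f 0) ends o a₁ a₂ a₃ b)
    (h₁ : HCov (Function.update p f 1) ends o a₁ a₂ a₃ b)
    (hg : Gaux p ends o a₁ a₂ u b) :
    HCov p ends o a₁ a₂ a₃ b :=
  HCov_of_update_zero_of_bern p hp ends o a₁ a₂ a₃ b f h₀ h₁
    (B1_nonneg_pendant_of_gaux p hp hf hleaf h3u h13 h23 ho3 hb3 hD h₀ h₁ hg)
    (B2_nonneg_pendant_of_gaux p hp hf hleaf h3u h13 h23 ho3 hb3 hD h₁ hg)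

end Main

end PendantA3

end Summit.Ventures.PercRepro2
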